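import Summits.ResolutionOfSingularities.ResolutionOfSingularities.Theorems.PurelyInseparableDim4Target
import Summits.ResolutionOfSingularities.ResolutionOfSingularities.Theorems.PurelyInseparableDim4Rules
import Summits.ResolutionOfSingularities.ResolutionOfSingularities.Theorems.PurelyInseparableDim4Scope
import Summits.ResolutionOfSingularities.ResolutionOfSingularities.Theorems.PurelyInseparableDim4SpineGame
import Summits.ResolutionOfSingularities.ResolutionOfSingularities.Theorems.PurelyInseparableDim4PolyhedraBoundary
import Summits.ResolutionOfSingularities.ResolutionOfSingularities.Theorems.PurelyInseparableDim4SpinePositional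
import HarnessLib

/-!
# [OURS · res-dim4-pi PR-9c, part 2] `PurePositionalWin4 q` from Spivakovsky's theorem in dimension ≤ 4

Cell `res-dim4-pi` (D-0157 DOOR 2, wave 2), brick **PR-9c** (seat `res-dim4-p-10`, «width 10»).  Parts 1a/1b
(`PurelyInseparableDim4PolyhedraGame`, `…PolyhedraBoundary`) proved that player A forces the STRICT win of Hironaka's constrained
polyhedra game on lattice positions from the NAMED HYPOTHESIS `PolyhedraGame.WeakWin` (Spivakovsky's printed
theorem, weak threshold) in every set of active coordinates.  Here:

* §1 the desk's spine game (`PurelyInseparableDim4SpineGame`) IS part 1's game for `σ = Fin 4`, all four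
  coordinates active: `pureMove = PolyhedraGame.move` and `SpinePermissible = PolyhedraGame.Permissible`
  definitionally, `SpineWon q ↔ PolyhedraGame.StrictWon q univ`;
* §2 a forcing tree puts the position in player A's attractor `Game.Wins` of the spine game read as an
  abstract reachability game (`res-dim4-p-14`'s `PurelyInseparableDim4GameDeterminacy`: legal move =
  «not yet won ∧ permissible `J`», answer = a chart `j ∈ J`); positional determinacy
  (`SpinePositional.purePositionalWin4_of_forall_wins`, `res-dim4-p-14`, the consortium interface of
  WORD #25 (e)) then yields
  **`purePositionalWin4_of_weakWin : (∀ I, PolyhedraGame.WeakWin (Fin 4) I) → 0 < q → PurePositionalWin4 q`**;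
  with `positionalWin4_of_purePositionalWin4` (PR-9a) and PR-9b this makes the frame's F4-S
  `SpineTerminatesSomeRule p p` depend on Spivakovsky's theorem [cite: Spivakovsky1983, Theorem p. 421] alone.
  (`PurePositionalWin4 0` is false — nothing is ever won at threshold `0` — hence `0 < q`.)

[OURS · counted 0 · elementary · AI work weaker than expert review] Statements about a combinatorial game on
supports; NOTHING here proves resolution of singularities in dimension ≥ 4 / characteristic `p`.
bears_on: LADDER-RESOLUTION:D157-DOOR2 (res-dim4-pi · PR-9c). Supports stmt-ResolutionOfSingularities-16155
(helper).
-/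

set_option linter.dupNamespace false -- mandated namespace of this single-conjunct summit

noncomputable section

namespace Summit.ResolutionOfSingularities.ResolutionOfSingularities.Theorems.PIDim4

namespace SpineWin

open Finset
open Literature.AlgebraicGeometry.Resolution
open Literature.AlgebraicGeometry.Resolution.CentreBlowup

/-! ## §1 The spine game is the lattice polyhedra game in `Fin 4`, all coordinates active -/

/-- `pureMove` is part 1's `move`. [folklore] -/
theorem pureMove_eq_move (q : ℕ) (J : Finset (Fin 4)) (j : Fin 4) (A : SpinePos) :
    pureMove q J j A = PolyhedraGame.move q J j A := rfl

/-- `SpinePermissible` is part 1's `Permissible`. [folklore] -/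
theorem spinePermissible_iff (q : ℕ) (J : Finset (Fin 4)) (A : SpinePos) :
    SpinePermissible q J A ↔ PolyhedraGame.Permissible q J A := Iff.rfl

/-- `SpineWon q` is part 1's strict win with all four coordinates active. [folklore] -/
theorem spineWon_iff (q : ℕ) (A : SpinePos) :
    SpineWon q A ↔ PolyhedraGame.StrictWon q Finset.univ A := by
  unfold SpineWon PolyhedraGame.StrictWon
  simp only [degIn_univ]

/-- Hence part 1's theorem read on the spine game: under Spivakovsky's hypothesis in every set of active
coordinates of `Fin 4`, player A forces the strict win from every spine position (`0 < q`). [folklore] -/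
theorem forces_spine (hweak : ∀ I : Finset (Fin 4), PolyhedraGame.WeakWin (Fin 4) I) {q : ℕ} (hq : 0 < q)
    (A : SpinePos) : PolyhedraGame.Forces (PolyhedraGame.StrictWon q Finset.univ) q Finset.univ A :=
  PolyhedraGame.forces_strict_of_weakWin Finset.univ (fun I _ => hweak I) hq A

/-! ## §2 Forcing trees give A's attractor of the spine game -/

/-- A forcing tree of part 1 puts the position in player A's attractor `Game.Wins` of the pure spine game
read as an abstract reachability game — legal move = «not yet won ∧ permissible `J`», answer = a chart
`j ∈ J` (`res-dim4-p-14`, `PurelyInseparableDim4GameDeterminacy` / `…SpinePositional`). [folklore] -/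
theorem wins_of_forces {q : ℕ} {A : SpinePos}
    (h : PolyhedraGame.Forces (PolyhedraGame.StrictWon q Finset.univ) q Finset.univ A) :
    Game.Wins
      (fun (A : SpinePos) (J : Finset (Fin 4)) => ¬ SpineWon q A ∧ SpinePermissible q J A)
      (fun A J A' => ∃ j ∈ J, A' = pureMove q J j A) A := by
  induction h with
  | won hW => exact Game.Wins.terminal fun J hJ => hJ.1 ((spineWon_iff q _).mpr hW)
  | @step P J _ hperm _ ih =>
    rcases Classical.em (SpineWon q P) with hw | hw
    · exact Game.Wins.terminal fun J hJ => hJ.1 hw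
    · refine Game.Wins.move (m := J) ⟨hw, hperm⟩ fun y hy => ?_
      obtain ⟨j, hj, rfl⟩ := hy
      exact ih j hj

end SpineWin

/-- **PR-9c.** Spivakovsky's theorem for Hironaka's polyhedra game (weak threshold), in every set of active
coordinates of `Fin 4` (part 1's NAMED HYPOTHESIS `PolyhedraGame.WeakWin`), implies that the desk's PURE spine
game — the STRICT game: «the chart origin is no longer `q`-fold» — has a positional winning strategy for
player A, for every exponent `q > 0`. [cite: Spivakovsky1983, Theorem p. 421] -/
theorem purePositionalWin4_of_weakWin (hweak : ∀ I : Finset (Fin 4), PolyhedraGame.WeakWin (Fin 4) I)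
    {q : ℕ} (hq : 0 < q) : PurePositionalWin4 q :=
  SpinePositional.purePositionalWin4_of_forall_wins q fun A =>
    SpineWin.wins_of_forces (SpineWin.forces_spine hweak hq A)

/-- `PurePositionalWin4 0` is FALSE as typed: at threshold `0` no non-empty position is ever won (degrees are
never `< 0`) and every `J ≠ ∅` is permissible, so B plays for ever from `{0}`. (Hence the `0 < q` above.)
[folklore] -/
theorem not_purePositionalWin4_zero : ¬ PurePositionalWin4 0 := by
  rintro ⟨σ, hperm, hno⟩
  -- the one-point position `{0}` is never won and every move keeps it non-empty and unwon
  have hnotwon : ∀ A : SpinePos, A.Nonempty → ¬ SpineWon 0 A := by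
    rintro A hne (hE | ⟨a, -, ha⟩)
    · exact hne.ne_empty hE
    · exact Nat.not_lt_zero _ ha
  -- build the infinite play by always answering with some `j ∈ σ A`
  have hmove : ∀ A : SpinePos, A.Nonempty → ∃ j ∈ σ A, (pureMove 0 (σ A) j A).Nonempty := by
    intro A hne
    obtain ⟨j, hj⟩ := (hperm A (hnotwon A hne)).1
    exact ⟨j, hj, hne.image _⟩
  choose f hf using hmove
  let next : {A : SpinePos // A.Nonempty} → {A : SpinePos // A.Nonempty} :=
    fun A => ⟨pureMove 0 (σ A.1) (f A.1 A.2) A.1, (hf A.1 A.2).2⟩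
  let start : {A : SpinePos // A.Nonempty} := ⟨{0}, Finset.singleton_nonempty 0⟩
  refine hno ⟨fun n => (next^[n] start).1, fun n => ⟨hnotwon _ (next^[n] start).2,
    f _ (next^[n] start).2, (hf _ (next^[n] start).2).1, ?_⟩⟩
  show (next^[n + 1] start).1 = (next (next^[n] start)).1
  rw [Function.iterate_succ_apply']

end Summit.ResolutionOfSingularities.ResolutionOfSingularities.Theorems.PIDim4

end
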